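import Mathlib
import Literature.Dynamics.Hamiltonian.KaloshinZhang2020.TheoremShapes
import Literature.Dynamics.Hamiltonian.KaloshinZhang2020.CuspSlices

/-!
# Kaloshin–Zhang 2020 vs Cheng–Xue: the KZ genericity class IMPLIES the CX genericity class (kernel-checked)

CITATION HEADER (lean-in-tree rule 2026-08-18). Sources: V. Kaloshin, K. Zhang, *Arnold diffusion for smooth
systems of two and a half degrees of freedom*, Annals of Mathematics Studies 208 (Princeton UP, 2020), Theorem 1.2
(§1.1 — scan chunk p0008 of the held unpaginated copy; printed page not held, §1.1 = printed pp. 3–7 by the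
book's table of contents) = bib key `KaloshinZhang2020` (the genericity class typed as `KZCuspGeneric` in
`KaloshinZhang2020/TheoremShapes.lean`); C.-Q. Cheng, J. Xue, *Arnold diffusion in nearly integrable Hamiltonian
systems of arbitrary degrees of freedom*, arXiv:1503.04153v5, §1 definition of "cusp-residual" (text sent to
print = Sci. China Math. 66 (2023)) = bib key `ChengXue2023`. PROVENANCE NOTE (cell DIVERGENCE D30; added 2026-08-18,
litref g10): the class typed as `CXCuspResidual` and proved here is the 2013/2015/CJM 2017/AJM 2019 FORM of the
definition (ℜ RESIDUAL in the sphere); v5 l.208 itself says ℜ OPEN-DENSE (`CXCuspOpenDense`, `TheoremShapes.lean`),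
and THAT class is NOT implied by `KZCuspGeneric`: `GenericityClassesCounterexample.lean`
(`exists_kzCuspGeneric_not_cxCuspOpenDense`, every finite-dimensional real normed space of dimension ≥ 2). Written by the
pub-arnold near-miss cell (LEMMAS §3 node G8′: typed comparison of the genericity classes).

WHAT IS PROVED. For ANY real normed space `Pert` of perturbations, ANY property `Good`, ANY set of directions
`𝒰` and ANY `a > 0`:  `KZCuspGeneric 𝒰 Good → CXCuspResidual a Good`.  In words: if `Good` holds on an open
dense subset `𝒲` of the Kaloshin–Zhang cusp `𝒱(𝒰, ε₀) = {εH₁ : H₁ ∈ 𝒰, 0 < ε < ε₀(H₁)}` (`𝒰` open dense in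
the unit sphere, `ε₀` lower semicontinuous, positive on `𝒰`), then `Good` is cusp-RESIDUAL in the sense of
Cheng–Xue: for a residual set `ℜ` of unit directions `P` there are `a_P ∈ (0, a]` and a residual `R_P ⊆ [0, a_P]`
with `Good (t • P)` for all `t ∈ R_P` (here even: `R_P` OPEN and dense in `(0, a_P)`, `a_P = min (a, ε₀ P)`,
`ℜ ⊇` a countable intersection of open dense sets `∩ 𝒰`).

PROOF = the abstract slice lemma L-gen-1 (`residual_setOf_slice_dense_of_relOpen`, `CuspSlices.lean`, which
needs NO hypothesis on the height function) transported along the polar-coordinate map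
`(λ, P) ↦ λ • P : ℝ₊ × 𝕊 → Pert ∖ {0}`; the one topological input is that this map is OPEN on products
`I × V` with `0 ∉ I` (Mathlib `IsOpen.smul_sphere`), plus uniqueness of polar coordinates on the unit sphere.
Lower semicontinuity of `ε₀` is NOT used (cell finding, LEMMAS §3 G8′ / DIVERGENCE L14): the converse
direction CX ⇒ KZ is where a regularity hypothesis on `P ↦ a_P` enters (`CuspDensity.lean`, hypothesis (l)); the
direction KZ ⇒ CX-v5 (open-dense ℜ) has a SECOND, independent obstruction — openness of the set of good directions —
which no hypothesis on the height removes (`GenericityClassesCounterexample.lean`).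
-/

open Set Filter Topology
open scoped Pointwise

namespace Literature.Dynamics.Hamiltonian.KaloshinZhang2020

variable {Pert : Type} [NormedAddCommGroup Pert] [NormedSpace ℝ Pert]

/-- Uniqueness of polar coordinates on the unit sphere: `s • P = t • Q` with `s, t > 0` and `‖P‖ = ‖Q‖ = 1`
forces `s = t` and `P = Q`. [folklore] -/
theorem eq_of_smul_unitSphere_eq {P Q : Pert} (hP : P ∈ unitSphere Pert) (hQ : Q ∈ unitSphere Pert)
    {s t : ℝ} (hs : 0 < s) (ht : 0 < t) (h : s • P = t • Q) : s = t ∧ P = Q := by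
  have hP1 : ‖P‖ = 1 := by simpa [unitSphere] using hP
  have hQ1 : ‖Q‖ = 1 := by simpa [unitSphere] using hQ
  have hst : s = t := by
    have hn := congrArg (fun v : Pert => ‖v‖) h
    simp only [norm_smul, Real.norm_eq_abs, hP1, hQ1, mul_one, abs_of_pos hs, abs_of_pos ht] at hn
    exact hn
  refine ⟨hst, ?_⟩
  subst hst
  calc P = s⁻¹ • (s • P) := by rw [inv_smul_smul₀ hs.ne']
    _ = s⁻¹ • (s • Q) := by rw [h]
    _ = Q := inv_smul_smul₀ hs.ne' Q

/-- **KZ-class genericity implies CX-class genericity** (LEMMAS G8′; L-gen-1 transported to the cone). For every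
real normed space of perturbations, every property `Good`, every direction set `𝒰` and every `a > 0`:
`KZCuspGeneric 𝒰 Good → CXCuspResidual a Good`. The residual set of directions produced is
`{P ∈ 𝕊 : the amplitude slice of 𝒲 over P is dense in (0, min(a, ε₀ P))} ∩ 𝒰`, and the residual set of
amplitudes over such a `P` is the (open) slice itself. No use is made of the lower semicontinuity of `ε₀`.
[folklore] -/
theorem KZCuspGeneric.cxCuspResidual {𝒰 : Set Pert} {Good : Pert → Prop}
    (h : KZCuspGeneric 𝒰 Good) {a : ℝ} (ha : 0 < a) : CXCuspResidual a Good := by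
  classical
  obtain ⟨h𝒰sub, h𝒰open, h𝒰dense⟩ := h.openDense
  obtain ⟨ε₀, -, -, hε₀pos, 𝒲, ⟨h𝒲sub, h𝒲open, h𝒲dense⟩, hgood⟩ := h.exists_eps
  -- the relatively open `𝒲` is `O ∩ cusp` for an open `O ⊆ Pert`
  obtain ⟨O, hOopen, hO⟩ := isOpen_induced_iff.mp h𝒲open
  have hOW : ∀ v ∈ cusp 𝒰 ε₀, v ∈ O ↔ v ∈ 𝒲 := by
    intro v hv
    have h1 := Set.ext_iff.mp hO ⟨v, hv⟩
    simpa using h1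
  -- density of `𝒲` in the cusp, read in `Pert`
  have h𝒲cl : cusp 𝒰 ε₀ ⊆ closure 𝒲 := by
    have h1 := Subtype.dense_iff.mp h𝒲dense
    rw [Subtype.image_preimage_coe] at h1
    exact h1.trans (closure_mono inter_subset_right)
  -- directions = the unit sphere as a space; height `a' = min a ε₀` on `𝒰`, `0` elsewhere
  let a' : unitSphere Pert → ℝ := fun P => if (P : Pert) ∈ 𝒰 then min a (ε₀ P) else 0
  let O' : Set (ℝ × unitSphere Pert) := {q | q.1 • (q.2 : Pert) ∈ O}
  have hO'open : IsOpen O' :=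
    hOopen.preimage (by fun_prop : Continuous fun q : ℝ × unitSphere Pert => q.1 • (q.2 : Pert))
  set W : Set (ℝ × unitSphere Pert) := O' ∩ cuspSet a' with hWdef
  -- KEY: the cusp over `a'` lies in the closure of `W` (cone openness, `IsOpen.smul_sphere`)
  have hWd : cuspSet a' ⊆ closure W := by
    rintro ⟨l, P⟩ ⟨hl0, hla⟩
    dsimp only at hl0 hla
    have hP𝒰 : (P : Pert) ∈ 𝒰 := by
      by_contra hP
      have h0 : a' P = 0 := by simp [a', hP]
      linarith
    have hla' : l < min a (ε₀ P) := by simpa [a', hP𝒰] using hla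
    have hla1 : l < a := lt_of_lt_of_le hla' (min_le_left _ _)
    have hlε : l < ε₀ P := lt_of_lt_of_le hla' (min_le_right _ _)
    have hv : l • (P : Pert) ∈ cusp 𝒰 ε₀ := ⟨P, hP𝒰, l, hl0, hlε, rfl⟩
    have hvcl : l • (P : Pert) ∈ closure 𝒲 := h𝒲cl hv
    rw [mem_closure_iff]
    intro o ho hmem
    obtain ⟨u, v, hu, hv', hlu, hPv, huv⟩ := isOpen_prod_iff.mp ho l P hmem
    -- shrink the amplitude window into `(0, a)`
    set I : Set ℝ := u ∩ Ioo 0 a with hI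
    have hIopen : IsOpen I := hu.inter isOpen_Ioo
    have hI0 : (0 : ℝ) ∉ I := fun h0 => lt_irrefl (0 : ℝ) h0.2.1
    have hlI : l ∈ I := ⟨hlu, hl0, hla1⟩
    -- the cone piece `I • v` is open in `Pert` and contains `l • P ∈ closure 𝒲`
    have hcone : IsOpen (I • (Subtype.val '' v : Set Pert)) :=
      IsOpen.smul_sphere one_ne_zero hIopen hI0 hv'
    have hmemcone : l • (P : Pert) ∈ I • (Subtype.val '' v : Set Pert) :=
      Set.smul_mem_smul hlI ⟨P, hPv, rfl⟩
    obtain ⟨w, hwcone, hw𝒲⟩ := mem_closure_iff.mp hvcl _ hcone hmemcone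
    obtain ⟨μ, hμI, y, ⟨Q, hQv, rfl⟩, rfl⟩ := Set.mem_smul.mp hwcone
    -- `μ • Q ∈ 𝒲 ⊆ cusp`: polar uniqueness puts `Q` in `𝒰` and `μ` below `ε₀ Q`
    obtain ⟨H₁, hH₁, ε, hε0, hεlt, hεeq⟩ := h𝒲sub hw𝒲
    have hμ0 : 0 < μ := hμI.2.1
    obtain ⟨hμε, hQH⟩ := eq_of_smul_unitSphere_eq Q.2 (h𝒰sub hH₁) hμ0 hε0 hεeq
    have hQ𝒰 : (Q : Pert) ∈ 𝒰 := hQH ▸ hH₁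
    have hμεQ : μ < ε₀ Q := by rw [hμε, hQH]; exact hεlt
    refine ⟨(μ, Q), ⟨huv (mk_mem_prod hμI.1 hQv), ?_, ?_⟩⟩
    · -- `(μ, Q) ∈ O'`
      show μ • (Q : Pert) ∈ O
      exact (hOW _ (h𝒲sub hw𝒲)).mpr hw𝒲
    · -- `(μ, Q) ∈ cuspSet a'`
      refine ⟨hμ0, ?_⟩
      show μ < a' Q
      simp only [a', hQ𝒰, if_true]
      exact lt_min hμI.2.2 hμεQ
  -- L-gen-1 (relative version): residually many directions with a dense amplitude slice
  have hres := residual_setOf_slice_dense_of_relOpen a' hO'open hWdef hWd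
  -- the good directions `𝒰` themselves are open dense, hence residual, in the sphere
  have h𝒰res : (Subtype.val ⁻¹' 𝒰 : Set (unitSphere Pert)) ∈ residual (unitSphere Pert) := residual_of_dense_open h𝒰open h𝒰dense
  refine ⟨_, inter_mem hres h𝒰res, ?_⟩
  rintro P ⟨hPres, hP𝒰⟩
  have hP𝒰' : (P : Pert) ∈ 𝒰 := hP𝒰
  have haP : a' P = min a (ε₀ P) := by simp [a', hP𝒰']
  have haP0 : 0 < min a (ε₀ P) := lt_min ha (hε₀pos _ hP𝒰')
  -- the good amplitudes over `P`: the slice of `W`, an OPEN dense subset of `(0, a_P)`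
  have hRsub : slice W P ∩ Ioo 0 (min a (ε₀ P)) ⊆ Icc 0 (min a (ε₀ P)) :=
    fun t ht => Ioo_subset_Icc_self ht.2
  have hRO : slice W P ∩ Ioo 0 (min a (ε₀ P)) = slice O' P ∩ Ioo 0 (min a (ε₀ P)) := by
    ext t
    simp only [hWdef, mem_inter_iff, mem_slice, mem_Ioo, cuspSet, mem_setOf_eq, haP]
    constructor
    · rintro ⟨⟨h1, -⟩, h2⟩
      exact ⟨h1, h2⟩
    · rintro ⟨h1, h2⟩
      exact ⟨⟨h1, h2.1, h2.2⟩, h2⟩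
  have hRopen : IsOpen (slice W P ∩ Ioo 0 (min a (ε₀ P))) := by
    rw [hRO]
    exact (isOpen_slice hO'open P).inter isOpen_Ioo
  have hRcl : Icc 0 (min a (ε₀ P)) ⊆ closure (slice W P ∩ Ioo 0 (min a (ε₀ P))) := by
    have h1 : Ioo 0 (min a (ε₀ P)) ⊆ closure (slice W P ∩ Ioo 0 (min a (ε₀ P))) := by
      have h2 : Ioo 0 (a' P) ⊆ closure (slice W P ∩ Ioo 0 (a' P)) := hPres
      rwa [haP] at h2
    calc Icc 0 (min a (ε₀ P)) = closure (Ioo 0 (min a (ε₀ P))) := (closure_Ioo haP0.ne).symm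
      _ ⊆ closure (slice W P ∩ Ioo 0 (min a (ε₀ P))) := closure_minimal h1 isClosed_closure
  refine ⟨min a (ε₀ P), haP0, min_le_left _ _, slice W P ∩ Ioo 0 (min a (ε₀ P)), hRsub, ?_, ?_⟩
  · -- residual (indeed open and dense) in `[0, a_P]`
    refine residual_of_dense_open (hRopen.preimage continuous_subtype_val) ?_
    rw [Subtype.dense_iff, Subtype.image_preimage_coe]
    exact hRcl.trans (closure_mono fun t ht => ⟨hRsub ht, ht⟩)
  · -- every amplitude in the slice is good: `t • P ∈ O ∩ cusp = 𝒲`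
    rintro t ⟨ht, ht0, htaP⟩
    have htO : t • (P : Pert) ∈ O := ht.1
    have htε : t < ε₀ P := lt_of_lt_of_le htaP (min_le_right _ _)
    have htcusp : t • (P : Pert) ∈ cusp 𝒰 ε₀ := ⟨P, hP𝒰', t, ht0, htε, rfl⟩
    exact hgood _ ((hOW _ htcusp).mp htO)

end Literature.Dynamics.Hamiltonian.KaloshinZhang2020
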